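import Summits.HodgeConjecture.HodgeConjecture.Theorems.Ring2WeilCoverageTypeNormSign
import Summits.HodgeConjecture.HodgeConjecture.Theorems.Ring2WeilCoverageLatticeNormTwist
import HarnessLib

/-!
# Weil-type family coverage — LATTICE–TYPE EXCHANGE: a lattice `𝔪` with `𝔪𝔪^ρ = (α₀)` carries a `Φ`-positive divisor of
# type `𝔣₀` iff the principal lattice carries one of type `(α₀)𝔣₀` (any CM field, any CM type, no hypothesis on units)

research route conditional on HC_CM; not a corollary; Q11.4-sentence-2 already refuted in dim ≥ 3.

Ring 2, WEIL-TYPE FAMILY-COVERAGE CENSUS (`HOME/WEIL-FAMILY-COVERAGE.md` `## b01`, blocks b01.40 (part 42's twist principle: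
the verdict of `ℂ^Φ/D(𝔪)` for a type `𝔣₀` is the verdict of `ℂ^{Φ_α}/D(𝔬)` for the TWISTED CM type `Φ_α`, `𝔪𝔪^ρ = (α)`; the
non-principal classes `𝔔 ∣ 13` of `ℤ[ζ₃₉]`, `𝔓 ∣ 2` of `ℤ[ζ₅₆]` FLIP the principal verdict, those of `ℤ[ζ₅₂]`, `ℤ[ζ₇₂]` do
not) and b01.42 (the norm-sign law: the verdict for `(ϖ₀)𝔣₀` vs `𝔣₀` on a fixed lattice); owner ring2-b01), part 59 of the
`Ring2WeilCoverage*` series.  The two twists are ONE: instead of twisting the CM type (part 42) one may twist the TYPE —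
for every CM field `K`, CM type `Φ`, lattice `𝔪` with `𝔪𝔪^ρ = (α₀)` (`α₀ ∈ 𝓞 K⁺ ∖ 0`, image `α ∈ K`) and type `𝔣₀`:

* §1 `isOfType_realMul_iff` — part 55's `isOfType_realMul` as an equivalence: `IsOfType 𝔪 (ϖζ₀) ((ϖ₀)𝔣₀) ↔
  IsOfType 𝔪 ζ₀ 𝔣₀` (`ϖ₀ ≠ 0`); `im_realMul_realMul_pos_iff`: `Im (α·α·ζ)^φ > 0 ↔ Im ζ^φ > 0` (`(Re α^φ)² > 0`).
* §2 **`exists_pos_isOfType_iff_one_realMul`: «`ℂ^Φ/D(𝔪)` carries a `Φ`-positive divisor of type `𝔣₀`» ⟺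
  «`ℂ^Φ/D(𝔬)` carries a `Φ`-positive divisor of type `(α₀)𝔣₀`»** — same `Φ`, NO hypothesis (`ζ ↦ α²ζ`: part 42's
  `IsOfType 𝔪 ζ 𝔣₀ ↔ IsOfType 1 (αζ) 𝔣₀`, then §1 with `ϖ₀ = α₀`; `α²` is totally positive, so `Φ`-positivity is kept);
  the principal case `exists_principal_iff_one_span` (`𝔣₀ = 𝔬₀`: «principal polarisation on `ℂ^Φ/D(𝔪)`» ⟺ «type `(α₀)`
  on `ℂ^Φ/D(𝔬)`»).

CONSEQUENCES (no new kernel statements needed, the level laws apply verbatim with `ϖ₀ ← α₀ϖ₀`): on every lattice class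
the type spectrum is the principal-lattice spectrum SHIFTED by `(α₀)` — at the `h = 1`/`h = 3` levels (parts 56a–h) type
`(ϖ₀)` on `ℂ^Φ/Φ(𝔪)` ⟺ `N_{K⁺/ℚ}(α₀ϖ₀) < 0` resp. `> 0` (part 45's totally positive `α` is the case `N(α₀) > 0` with all
signs `+`); at `39/56` (parts 58c/58d) type `(ϖ₀)` on `ℂ^Φ/Φ(𝔔)` ⟺ the relative law for `α₀ϖ₀`, i.e. the two parities flip
by the signs of `N_{K⁺/ℚ(s)}(α₀)·N_{K⁺/ℚ(s)}(ϖ₀)` at the two places — b01.40's «the class `[𝔔]` flips the verdict» is the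
case `ϖ₀ = 1`.  HONEST FRAMING: torus-level statements about Shimura's divisors of type `(K; Φ; 𝔣₀)` [Sh98 §14.3–14.4];
nothing here is a statement about Hodge classes, `W_K`, general members or HC; `HC_CM` is used nowhere.  No `def`, no
named fact, no `sorry`.

References: [cite: Shimura1998, §14.3 Prop. 4–5, pp. 103–104; §14.4 Prop. 7, p. 105]; census b01.40 / b01.42
(seat-derived).
-/

noncomputable section

open scoped Classical nonZeroDivisors NumberField ComplexConjugate
open NumberField NumberField.ComplexEmbedding Module FractionalIdeal Complex Polynomial

namespace Summit.HodgeConjecture.Ring2WeilCoverage.LatticeTypeExchange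

open Literature.AlgebraicGeometry.Motives (CMType)
open Literature.NumberTheory.ComplexMultiplication
open Literature.NumberTheory.ComplexMultiplication.CMTypeLattice
open Summit.HodgeConjecture.Ring2WeilCoverage.CMTypeSignParity
open Summit.HodgeConjecture.Ring2WeilCoverage.CMUnitSignature
open Summit.HodgeConjecture.Ring2WeilCoverage.TypeNormSign
open Summit.HodgeConjecture.Ring2WeilCoverage.LatticeNormTwist (isOfType_iff_isOfType_one_mul im_embedding_mul_of_real')

variable {K : Type} [Field K] [NumberField K] [IsCMField K] (Φ : CMType K)
  (𝔪 : (FractionalIdeal (𝓞 K)⁰ K)ˣ) {𝔣₀ : Ideal (𝓞 (maximalRealSubfield K))}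

/-- the image in `K` of an integer of the maximal real subfield. -/
local notation3 (prettyPrint := false) "𝓇 " x:max => (algebraMap (𝓞 (maximalRealSubfield K)) K x)

/-! ### §1 Part 55's type multiplication as an equivalence; positivity under a real square -/

/-- **`IsOfType 𝔪 (ϖζ₀) ((ϖ₀)𝔣₀) ↔ IsOfType 𝔪 ζ₀ 𝔣₀`** for `ϖ₀ ∈ 𝓞 K⁺ ∖ 0` (cancel the invertible fractional ideal `(ϖ)`).
research route conditional on HC_CM; not a corollary; Q11.4-sentence-2 already refuted in dim ≥ 3. [cite: Shimura1998, §14.3 Prop. 4–5, pp. 103–104] -/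
theorem isOfType_realMul_iff {ϖ₀ : 𝓞 (maximalRealSubfield K)} (hϖ0 : ϖ₀ ≠ 0) (ζ₀ : K)
    (𝔣₀ : Ideal (𝓞 (maximalRealSubfield K))) :
    IsOfType 𝔪 (𝓇 ϖ₀ * ζ₀) (Ideal.span {ϖ₀} * 𝔣₀) ↔ IsOfType 𝔪 ζ₀ 𝔣₀ := by
  have hne : spanSingleton (𝓞 K)⁰ (𝓇 ϖ₀) ≠ 0 :=
    spanSingleton_ne_zero_iff.mpr (algebraMap_ringOfIntegers_ne_zero hϖ0)
  rw [isOfType_iff, isOfType_iff, Ideal.map_mul, Ideal.map_span, Set.image_singleton, FractionalIdeal.coeIdeal_mul,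
    FractionalIdeal.coeIdeal_span_singleton, ← FractionalIdeal.spanSingleton_mul_spanSingleton,
    ← IsScalarTower.algebraMap_apply (𝓞 (maximalRealSubfield K)) (𝓞 K) K]
  constructor
  · intro h
    apply mul_left_cancel₀ hne
    rw [h]
    simp only [mul_assoc]
  · intro h
    rw [h]
    simp only [mul_assoc]

/-- `Im (α·(α·ζ))^φ > 0 ↔ Im ζ^φ > 0` for a non-zero real `α` (`Im (α²ζ)^φ = (Re α^φ)² · Im ζ^φ`).
research route conditional on HC_CM; not a corollary; Q11.4-sentence-2 already refuted in dim ≥ 3. [folklore] -/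
theorem im_realMul_realMul_pos_iff {α : K} (hα : IsCMField.complexConj K α = α) (h0 : α ≠ 0) (ζ : K)
    (φ : K →+* ℂ) : 0 < (φ (α * (α * ζ))).im ↔ 0 < (φ ζ).im := by
  rw [im_embedding_mul_of_real' hα, im_embedding_mul_of_real' hα, ← mul_assoc]
  have hsq : 0 < (φ α).re * (φ α).re := mul_self_pos.mpr (re_embedding_ne_zero_of_real hα h0 φ)
  exact ⟨fun h => pos_of_mul_pos_right h hsq.le, fun h => mul_pos hsq h⟩

/-! ### §2 Lattice–type exchange -/

/-- **LATTICE–TYPE EXCHANGE.**  For ANY CM field `K`, CM type `Φ`, lattice `𝔪` with `𝔪𝔪^ρ = (α)`, `α` the image of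
`α₀ ∈ 𝓞 K⁺ ∖ 0`, and any type `𝔣₀`: **`ℂ^Φ/D(𝔪)` carries a `Φ`-positive divisor of type `𝔣₀` iff `ℂ^Φ/D(𝔬)` carries one
of type `(α₀)𝔣₀`** (`X_ζ` on `D(𝔪)` ↦ `X_{α²ζ}` on `D(𝔬)`: part 42's `IsOfType 𝔪 ζ 𝔣₀ ↔ IsOfType 1 (αζ) 𝔣₀` and §1;
`α² ≫ 0` keeps positivity).  No hypothesis on units, class groups or `Φ`.
research route conditional on HC_CM; not a corollary; Q11.4-sentence-2 already refuted in dim ≥ 3. [cite: Shimura1998, §14.3 Prop. 4–5, pp. 103–104; §14.4 Prop. 7, p. 105] -/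
theorem exists_pos_isOfType_iff_one_realMul {α₀ : 𝓞 (maximalRealSubfield K)} (hα0 : α₀ ≠ 0)
    (h𝔪 : (𝔪 : FractionalIdeal (𝓞 K)⁰ K) * (conjIdeal 𝔪 : FractionalIdeal (𝓞 K)⁰ K) = spanSingleton (𝓞 K)⁰ (𝓇 α₀))
    (𝔣₀ : Ideal (𝓞 (maximalRealSubfield K))) :
    (∃ ζ : K, IsCMField.complexConj K ζ = -ζ ∧ (∀ φ : Φ.1, 0 < (φ.1 ζ).im) ∧ IsOfType 𝔪 ζ 𝔣₀) ↔
      ∃ ζ : K, IsCMField.complexConj K ζ = -ζ ∧ (∀ φ : Φ.1, 0 < (φ.1 ζ).im) ∧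
        IsOfType 1 ζ (Ideal.span {α₀} * 𝔣₀) := by
  have hα : IsCMField.complexConj K (𝓇 α₀) = 𝓇 α₀ := complexConj_algebraMap_ringOfIntegers α₀
  have hαne : 𝓇 α₀ ≠ 0 := algebraMap_ringOfIntegers_ne_zero hα0
  constructor
  · rintro ⟨ζ, hζ, hpos, hT⟩
    refine ⟨𝓇 α₀ * (𝓇 α₀ * ζ), ?_, fun φ => ?_, ?_⟩
    · rw [map_mul, map_mul, hα, hζ]; ring
    · exact (im_realMul_realMul_pos_iff hα hαne ζ φ.1).mpr (hpos φ)
    · exact (isOfType_realMul_iff 1 hα0 _ 𝔣₀).mpr ((isOfType_iff_isOfType_one_mul 𝔪 h𝔪 ζ 𝔣₀).mp hT)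
  · rintro ⟨η, hη, hpos, hT⟩
    refine ⟨(𝓇 α₀)⁻¹ * ((𝓇 α₀)⁻¹ * η), ?_, fun φ => ?_, ?_⟩
    · rw [map_mul, map_mul, map_inv₀, hα, hη]; ring
    · have hkey : 𝓇 α₀ * (𝓇 α₀ * ((𝓇 α₀)⁻¹ * ((𝓇 α₀)⁻¹ * η))) = η := by field_simp
      have := (im_realMul_realMul_pos_iff hα hαne ((𝓇 α₀)⁻¹ * ((𝓇 α₀)⁻¹ * η)) φ.1).mp (by rw [hkey]; exact hpos φ)
      exact this
    · rw [isOfType_iff_isOfType_one_mul 𝔪 h𝔪 _ 𝔣₀, ← mul_assoc, mul_inv_cancel₀ hαne, one_mul,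
        ← isOfType_realMul_iff 1 hα0 _ 𝔣₀, ← mul_assoc, mul_inv_cancel₀ hαne, one_mul]
      exact hT

/-- **The principal case**: «`ℂ^Φ/D(𝔪)` carries an `ι`-compatible PRINCIPAL polarisation» ⟺ «`ℂ^Φ/D(𝔬)` carries a
`Φ`-positive divisor of type `(α₀)`» (`𝔪𝔪^ρ = (α₀)`) — so every level law for the types `(ϖ₀)` on the principal torus
(parts 56a–h, 58c/58d) is at once the law for principal polarisations on the other lattice classes (with `ϖ₀ ← α₀`), and
for their types `(ϖ₀)` (with `ϖ₀ ← α₀ϖ₀`, `exists_pos_isOfType_span_iff_one_span_mul`).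
research route conditional on HC_CM; not a corollary; Q11.4-sentence-2 already refuted in dim ≥ 3. [cite: Shimura1998, §14.4 Prop. 7, p. 105] -/
theorem exists_principal_iff_one_span {α₀ : 𝓞 (maximalRealSubfield K)} (hα0 : α₀ ≠ 0)
    (h𝔪 : (𝔪 : FractionalIdeal (𝓞 K)⁰ K) * (conjIdeal 𝔪 : FractionalIdeal (𝓞 K)⁰ K) = spanSingleton (𝓞 K)⁰ (𝓇 α₀)) :
    (∃ ζ : K, IsCMField.complexConj K ζ = -ζ ∧ (∀ φ : Φ.1, 0 < (φ.1 ζ).im) ∧ IsOfType 𝔪 ζ ⊤) ↔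
      ∃ ζ : K, IsCMField.complexConj K ζ = -ζ ∧ (∀ φ : Φ.1, 0 < (φ.1 ζ).im) ∧ IsOfType 1 ζ (Ideal.span {α₀}) := by
  have h := exists_pos_isOfType_iff_one_realMul Φ 𝔪 hα0 h𝔪 ⊤
  rwa [Ideal.mul_top] at h

/-- **Types on the other lattice classes**: «type `(ϖ₀)` on `ℂ^Φ/D(𝔪)`» ⟺ «type `(α₀ϖ₀)` on `ℂ^Φ/D(𝔬)`»
(`𝔪𝔪^ρ = (α₀)`).
research route conditional on HC_CM; not a corollary; Q11.4-sentence-2 already refuted in dim ≥ 3. [cite: Shimura1998, §14.4 Prop. 7, p. 105] -/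
theorem exists_pos_isOfType_span_iff_one_span_mul {α₀ : 𝓞 (maximalRealSubfield K)} (hα0 : α₀ ≠ 0)
    (h𝔪 : (𝔪 : FractionalIdeal (𝓞 K)⁰ K) * (conjIdeal 𝔪 : FractionalIdeal (𝓞 K)⁰ K) = spanSingleton (𝓞 K)⁰ (𝓇 α₀))
    (ϖ₀ : 𝓞 (maximalRealSubfield K)) :
    (∃ ζ : K, IsCMField.complexConj K ζ = -ζ ∧ (∀ φ : Φ.1, 0 < (φ.1 ζ).im) ∧ IsOfType 𝔪 ζ (Ideal.span {ϖ₀})) ↔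
      ∃ ζ : K, IsCMField.complexConj K ζ = -ζ ∧ (∀ φ : Φ.1, 0 < (φ.1 ζ).im) ∧
        IsOfType 1 ζ (Ideal.span {α₀ * ϖ₀}) := by
  rw [exists_pos_isOfType_iff_one_realMul Φ 𝔪 hα0 h𝔪 (Ideal.span {ϖ₀}), Ideal.span_singleton_mul_span_singleton]

end Summit.HodgeConjecture.Ring2WeilCoverage.LatticeTypeExchange

end
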